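import Mathlib.NumberTheory.NumberField.CMField
import Mathlib.Analysis.Matrix.Spectrum
import Mathlib.LinearAlgebra.Matrix.GeneralLinearGroup.Defs
import Mathlib.Analysis.Calculus.FDeriv.Basic
import Mathlib.Algebra.Field.Subfield.Basic

/-!
# HodgeRepro2 — Shimura data of the compact ball-quotient transfer, and the printed
non-vanishing input instantiated on it (statements only)

Blind re-derivation cell `pub-hodge-repro2`, seat p2.  Statement shapes only: definitions and
`Prop`s transcribing the printed objects of the two located sources, specialised to the
transfer's data (a CM field `K`, a hermitian form on `K³` of signature `(2,1)` at one real
place of the maximal real subfield and definite at the others, a congruence subgroup, the 2-ball).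

## Printed sources (locators as printed)

* **[Sh79]** G. Shimura, *Automorphic forms and the periods of abelian varieties*,
  J. Math. Soc. Japan 31 (1979), no. 3, 561–592.  §3 (pp. 571–572): `U(r,s)`, the domain
  `𝔇(r,s)` (3.2) and the factors of automorphy (3.4)–(3.7); §4 (pp. 573–576): the group
  `G_ℚ = {α ∈ GL_m(K) | α T ᵗα^ρ = T}` (4.1), the signatures `(r_ν, s_ν)` of `-iT^{τ_ν}`
  (4.2), the congruence subgroups `Γ_N` (4.14); §8 (pp. 588–590): **Theorem 8.1**
  (p. 588): for `s₁ = 1`, `s₂ = ⋯ = s_g = 0` there is a finite-index subgroup `Γ ⊂ Γ₁` and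
  `m-1` closed holomorphic 1-forms `ξ₁, …, ξ_{m-1}` on `Γ\𝔇_{m-1}` with
  `ξ₁ ∧ ⋯ ∧ ξ_{m-1} ≠ 0`; `Γ\𝔇` is compact if `g > 1`.
* **[DR15]** M. Dimitrov, D. Ramakrishnan, *Arithmetic quotients of the complex ball and a
  conjecture of Lang*, Doc. Math. 20 (2015), 1185–1205 (arXiv:1401.1628).  Introduction:
  the unitary group `G` over the totally real `F` of a hermitian form on `M^{n+1}` of
  signature `(n,1)` at one infinite place `ι` and `(n+1,0)` or `(0,n+1)` at the others;
  Definition 1.3: `Γ(𝔑)`, `Γ₀(𝔑)`, `Γ₁(𝔑)`; §2.2: "Non-vanishing of `q(Y_Γ)` for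
  sufficiently small congruence subgroups is known by a theorem of Shimura [shimura]";
  Definition 3.1 / Theorem 3.2 (Rogawski): the packets `Π(λ,ν)`; Proposition 3.6:
  `q(Y_{Γ₁(𝔠) ∩ Γ₀(𝔭𝔮)}) > 2`.

## Dictionary (printed symbol ↦ this file)

| printed | here |
|---|---|
| `K` CM-field, `ρ` complex conjugation, `K₀ = K^ρ` ([Sh79] §1) ; `M`, `F` ([DR15]) | `K` with `[IsCMField K]`, `ρ := IsCMField.complexConj K`, `maximalRealSubfield K` |
| `T ∈ GL_m(K)`, `ᵗT^ρ = -T` ([Sh79] (4.1)) ; hermitian form on `M^{n+1}` ([DR15]) | `H : Matrix (Fin (n+1)) (Fin (n+1)) K` with `IsHermitianForm K H` (`T = ζ H`, see `IsPicardSignature`) |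
| signature `(r_ν, s_ν)` of `-iT^{τ_ν}` ([Sh79] (4.2)) | `signatureAt τ H` (numbers of positive / negative eigenvalues of `τ(H)`) |
| `G_ℚ = {α ∣ α T ᵗα^ρ = T}` ([Sh79] (4.1)) ; `G` ([DR15]) | `unitaryGroup K H ≤ GL (Fin (n+1)) K` |
| `𝔪 ⊂ K¹_m` lattice, `Γ_N` ([Sh79] (4.14)) | `shimuraLevel K H 𝔪 N` (a `Set`; (4.14) verbatim) |
| `Γ(𝔑), Γ₀(𝔑), Γ₁(𝔑)` ([DR15] Def. 1.3) | `principalCongruence`, `congruence₀`, `congruence₁` |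
| `𝔇_r = 𝔇(r,1)` ([Sh79] (8.1)) ; `𝔥²_ℂ` ([DR15] §1) | `ball₂` |
| action of `U(2,1)` on `𝔇(2,1)` ([Sh79] (3.3)–(3.4)) | `ballAction` (projective action in the affine chart) |
| closed holomorphic 1-form on `Γ\𝔇` ([Sh79] §8) | `IsHolomorphicOneForm`, `IsClosedOneForm`, `IsInvariantUnder` |
| `ξ₁ ∧ ξ₂ ≠ 0` ([Sh79] Thm 8.1) | `WedgeNonzero` |
| `q(Y_Γ)` ([DR15] §2), `q(Y_Γ) > 2` ([DR15] Prop. 3.6) | `IrregularityAtLeast`, `DR15Prop36Shape` |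
| reflex field of the Shimura datum ([DR15] §1: "the reflex field `M`") | `reflexField` (fixed field of the stabiliser of the Hodge-type function) |

## Not here: the (S4) side (CM types, cube, rank-four faces, corner products, Weil classes: seat p1,
`Defs.lean`); the adelic datum `(λ, ν) ∈ Ξ` of [DR15] Def. 3.1 (second file); canonical
models as varieties (no analytification in Mathlib).  No proof is claimed: `ShimuraThm81Instance`
is the conclusion of [Sh79] Theorem 8.1 on the transfer's data, packaged as a `Prop`.
-/

namespace Summit.Ventures.HodgeRepro2.ShimuraData

open NumberField Matrix

noncomputable section

section HermitianData

variable (K : Type*) [Field K] [NumberField K] [IsCMField K]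

/-- The complex conjugation `ρ` of the CM-field `K` ([Sh79] §1, p. 562: the automorphism `ρ` of
order 2 with `στ = τρ` for every injection `τ` of `K` into `ℂ`, `σ` = complex conjugation),
Mathlib's `NumberField.IsCMField.complexConj`. -/
abbrev ρ : K ≃ₐ[maximalRealSubfield K] K := IsCMField.complexConj K

variable {m : ℕ}

/-- `ᵗg^ρ`: the `ρ`-conjugate transpose of a matrix over `K` ([Sh79] (4.1) writes `ᵗα^ρ`). -/
def conjTransposeK (g : Matrix (Fin m) (Fin m) K) : Matrix (Fin m) (Fin m) K :=
  (g.map (ρ K))ᵀ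

/-- `H` is a hermitian matrix over `K` relative to `ρ`: `ᵗH^ρ = H`.  [DR15] Introduction:
"a hermitian form on `M^{n+1}`"; [Sh79] works with the skew-hermitian `T = ζ H`
(`ᵗT^ρ = -T`), `ζ ∈ K` with `ζ^ρ = -ζ`. -/
def IsHermitianForm (H : Matrix (Fin m) (Fin m) K) : Prop := conjTransposeK K H = H

variable {K}

/-- `ᵗ(AB)^ρ = ᵗB^ρ ᵗA^ρ`: the `ρ`-conjugate transpose is anti-multiplicative. -/
theorem conjTransposeK_mul (A B : Matrix (Fin m) (Fin m) K) :
    conjTransposeK K (A * B) = conjTransposeK K B * conjTransposeK K A := by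
  ext i j
  simp only [conjTransposeK, transpose_apply, map_apply, mul_apply, map_sum, map_mul]
  exact Finset.sum_congr rfl fun k _ => mul_comm _ _

/-- `ᵗ1^ρ = 1`. -/
theorem conjTransposeK_one : conjTransposeK K (1 : Matrix (Fin m) (Fin m) K) = 1 := by
  rw [conjTransposeK, Matrix.map_one (⇑(ρ K)) (map_zero _) (map_one _), Matrix.transpose_one]

/-- The `ρ`-conjugate transpose is an involution (`ρ² = 1`). -/
theorem conjTransposeK_conjTransposeK (A : Matrix (Fin m) (Fin m) K) :
    conjTransposeK K (conjTransposeK K A) = A := by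
  ext i j; simp [conjTransposeK, IsCMField.complexConj_apply_apply]

/-- The complex matrix `τ(H)` is hermitian (in Mathlib's sense, over `ℂ`) when `H` is hermitian
over `K`: uses `τ ∘ ρ = conj ∘ τ` (`IsCMField.complexEmbedding_complexConj`). -/
theorem isHermitian_map_of_isHermitianForm {H : Matrix (Fin m) (Fin m) K}
    (hH : IsHermitianForm K H) (τ : K →+* ℂ) : (H.map τ).IsHermitian := by
  refine Matrix.IsHermitian.ext fun i j => ?_
  have h : conjTransposeK K H i j = H i j := by rw [hH]
  simp only [conjTransposeK, transpose_apply, map_apply] at h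
  rw [map_apply, map_apply, ← h, IsCMField.complexEmbedding_complexConj, Complex.star_def]

variable (K)

/-- The signature `(p, q)` of the complex hermitian matrix `τ(H)`: `p` (resp. `q`) positive
(resp. negative) eigenvalues.  [Sh79] (4.2): `(r_ν, s_ν)` = signature of `-iT^{τ_ν}`;
[DR15] Introduction: "signature `(n,1)` at one infinite place `ι` and `(n+1,0)` or `(0,n+1)` at
the others".  The value does not depend on the choice of `τ` within its infinite place
(`τ̄(H) = τ(H)ᵀ` has the same eigenvalues).  Junk value `(0,0)` if `τ(H)` is not hermitian. -/
def signatureAt (τ : K →+* ℂ) (H : Matrix (Fin m) (Fin m) K) : ℕ × ℕ :=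
  if h : (H.map τ).IsHermitian then
    ((Finset.univ.filter fun i => 0 < h.eigenvalues i).card,
     (Finset.univ.filter fun i => h.eigenvalues i < 0).card)
  else (0, 0)

/-- `τ(H)` is definite (signature `(m,0)` or `(0,m)`), [DR15] "`(n+1,0)` or `(0,n+1)`". -/
def IsDefiniteAt (τ : K →+* ℂ) (H : Matrix (Fin m) (Fin m) K) : Prop :=
  signatureAt K τ H = (m, 0) ∨ signatureAt K τ H = (0, m)

/-- The **Picard signature condition** of the transfer, for a hermitian form on `K^{n+1}`:
signature `(n,1)` at the infinite place of `τ₁` and definite at every other infinite place.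
[DR15] Introduction (hypothesis on `G`); [Sh79] Theorem 8.1 hypothesis `s₁ = 1`,
`s₂ = ⋯ = s_g = 0` (there `(r_ν, s_ν)` is the signature of `-iT^{τ_ν}` w.r.t. the CM-type
`τ₁, …, τ_g`, and `-iT^{τ_ν ρ}` has signature `(s_ν, r_ν)`, so `(0, m)` at some `τ_ν` is
`(m, 0)` at `τ_ν ρ`).  The transfer uses `n = 2`. -/
def IsPicardSignature {n : ℕ} (τ₁ : K →+* ℂ) (H : Matrix (Fin (n + 1)) (Fin (n + 1)) K) :
    Prop :=
  signatureAt K τ₁ H = (n, 1) ∧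
    ∀ τ : K →+* ℂ, InfinitePlace.mk τ ≠ InfinitePlace.mk τ₁ → IsDefiniteAt K τ H

/-- The **unitary group** of `H` ([Sh79] (4.1): `G_ℚ = {α ∈ GL_m(K) | α T ᵗα^ρ = T}`; [DR15]
Introduction: "the unitary group `G` over `F` defined by a hermitian form on `M^{n+1}`"),
as the subgroup of `GL_m(K)` of `g` with `ᵗg^ρ H g = H` (column vectors, left action).
[Sh79] lets `G_ℚ` act on row vectors from the right, `x ↦ xα`, so for `T = ζH` its `G_ℚ` is
the image of this group under the anti-automorphism `g ↦ ᵗg^ρ` (`α = ᵗg^ρ`). -/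
def unitaryGroup (H : Matrix (Fin m) (Fin m) K) : Subgroup (GL (Fin m) K) where
  carrier := {g | conjTransposeK K (g : Matrix (Fin m) (Fin m) K) * H * g = H}
  one_mem' := by simp [conjTransposeK_one]
  mul_mem' := by
    intro a b ha hb
    simp only [Set.mem_setOf_eq] at ha hb ⊢
    set A : Matrix (Fin m) (Fin m) K := (a : Matrix (Fin m) (Fin m) K) with hA
    set B : Matrix (Fin m) (Fin m) K := (b : Matrix (Fin m) (Fin m) K) with hB
    have hab : ((a * b : GL (Fin m) K) : Matrix (Fin m) (Fin m) K) = A * B := Units.val_mul a b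
    rw [hab, conjTransposeK_mul]
    calc conjTransposeK K B * conjTransposeK K A * H * (A * B)
        = conjTransposeK K B * (conjTransposeK K A * H * A) * B := by
          simp only [Matrix.mul_assoc]
      _ = H := by rw [ha, hb]
  inv_mem' := by
    intro a ha
    simp only [Set.mem_setOf_eq] at ha ⊢
    set A : Matrix (Fin m) (Fin m) K := (a : Matrix (Fin m) (Fin m) K) with hA
    set B : Matrix (Fin m) (Fin m) K := ((a⁻¹ : GL (Fin m) K) : Matrix (Fin m) (Fin m) K) with hB
    have hAB : A * B = 1 := by rw [hA, hB, ← Units.val_mul, mul_inv_cancel, Units.val_one]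
    have hCBA : conjTransposeK K B * conjTransposeK K A = 1 := by
      rw [← conjTransposeK_mul, hAB, conjTransposeK_one]
    calc conjTransposeK K B * H * B
        = conjTransposeK K B * (conjTransposeK K A * H * A) * B := by rw [ha]
      _ = (conjTransposeK K B * conjTransposeK K A) * H * (A * B) := by
          simp only [Matrix.mul_assoc]
      _ = H := by rw [hCBA, hAB, Matrix.one_mul, Matrix.mul_one]

/-- The special unitary group `det γ = 1` ([Sh79] (4.14) imposes `det(γ) = 1`; [DR15] §2.1
`G¹ = ker(det : G → M¹)`). -/
def specialUnitaryGroup (H : Matrix (Fin m) (Fin m) K) : Subgroup (GL (Fin m) K) :=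
  unitaryGroup K H ⊓ (Matrix.GeneralLinearGroup.det : GL (Fin m) K →* Kˣ).ker

end HermitianData

section Levels

variable (K : Type*) [Field K] [NumberField K] [IsCMField K] {m : ℕ}

/-- A `ℤ`-lattice in `K¹_m = K^m` (row vectors), [Sh79] §4: `𝔪 = Σ_{j=1}^{2n} ℤ h_j` with
`{h_j}` a `ℚ`-basis of `K¹_m`; Theorem 8.1 allows an arbitrary lattice `𝔪` of `K¹_m`. -/
def IsLattice (𝔪 : Submodule ℤ (Fin m → K)) : Prop :=
  Module.Finite ℤ 𝔪 ∧ Submodule.span ℚ (𝔪 : Set (Fin m → K)) = ⊤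

/-- [Sh79] (4.14) verbatim: `Γ_N = {γ ∈ G_ℚ | det(γ) = 1, 𝔪γ = 𝔪, 𝔪(1-γ) ⊂ N𝔪}`, `N` a positive
integer, `𝔪` a lattice in `K¹_m`; row vectors act on the right (`x ↦ xγ`).  `Γ₁` (`N = 1`) is
the group in the hypothesis of Theorem 8.1. -/
def shimuraLevel (H : Matrix (Fin m) (Fin m) K) (𝔪 : Submodule ℤ (Fin m → K)) (N : ℕ) :
    Set (GL (Fin m) K) :=
  {γ | γ ∈ specialUnitaryGroup K H ∧
    (∀ x ∈ 𝔪, Matrix.vecMul x (γ : Matrix (Fin m) (Fin m) K) ∈ 𝔪) ∧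
    (∀ x ∈ 𝔪, Matrix.vecMul x ((γ⁻¹ : GL (Fin m) K) : Matrix (Fin m) (Fin m) K) ∈ 𝔪) ∧
    (∀ x ∈ 𝔪, ∃ y ∈ 𝔪, x - Matrix.vecMul x (γ : Matrix (Fin m) (Fin m) K) = (N : ℤ) • y)}

/-- `G(𝔬)` of [DR15] Introduction: "the stabilizer in `G(F)` of `𝔒^{n+1}`", i.e. the elements
of the unitary group with entries in `𝓞 K` whose inverse also has entries in `𝓞 K`. -/
def integralUnitaryGroup (H : Matrix (Fin m) (Fin m) K) : Set (GL (Fin m) K) :=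
  {γ | γ ∈ unitaryGroup K H ∧
    (∀ i j, IsIntegral ℤ ((γ : Matrix (Fin m) (Fin m) K) i j)) ∧
    (∀ i j, IsIntegral ℤ (((γ⁻¹ : GL (Fin m) K) : Matrix (Fin m) (Fin m) K) i j))}

/-- `γ ≡ 1 (mod 𝔑)` entrywise, for an ideal `𝔑 ⊂ 𝓞 K` and an integral matrix `γ`:
`γ_{ij} - δ_{ij} ∈ 𝔑` (as elements of `K`, `𝔑` mapped into `K`). -/
def CongruentToOne (𝔑 : Ideal (𝓞 K)) (γ : Matrix (Fin m) (Fin m) K) : Prop :=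
  ∀ i j, ∃ a ∈ 𝔑, γ i j - (1 : Matrix (Fin m) (Fin m) K) i j = (algebraMap (𝓞 K) K) a

/-- [DR15] Definition 1.3, `Γ(𝔑)`: the kernel of `G(𝔬) ↪ GL(n+1, 𝔒) → GL(n+1, 𝔒/𝔑)`. -/
def principalCongruence (H : Matrix (Fin m) (Fin m) K) (𝔑 : Ideal (𝓞 K)) : Set (GL (Fin m) K) :=
  {γ | γ ∈ integralUnitaryGroup K H ∧ CongruentToOne K 𝔑 (γ : Matrix (Fin m) (Fin m) K)}

/-- [DR15] Definition 1.3, `Γ₀(𝔑)`: inverse image of the upper triangular matrices. -/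
def congruence₀ (H : Matrix (Fin m) (Fin m) K) (𝔑 : Ideal (𝓞 K)) : Set (GL (Fin m) K) :=
  {γ | γ ∈ integralUnitaryGroup K H ∧
    ∀ i j : Fin m, j < i → ∃ a ∈ 𝔑, (γ : Matrix (Fin m) (Fin m) K) i j = (algebraMap (𝓞 K) K) a}

/-- [DR15] Definition 1.3, `Γ₁(𝔑)`: inverse image of the upper unipotent matrices. -/
def congruence₁ (H : Matrix (Fin m) (Fin m) K) (𝔑 : Ideal (𝓞 K)) : Set (GL (Fin m) K) :=
  {γ | γ ∈ congruence₀ K H 𝔑 ∧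
    ∀ i : Fin m, ∃ a ∈ 𝔑, (γ : Matrix (Fin m) (Fin m) K) i i - 1 = (algebraMap (𝓞 K) K) a}

/-- "`Γ` is a subgroup of finite index of `Γ₁`" for two subsets of `GL_m(K)` given as sets:
both are (the carriers of) subgroups and `Γ` has finite index in `Γ₁`.  Used for the
conclusion of [Sh79] Theorem 8.1 ("a subgroup `Γ` of `Γ₁` of finite index"). -/
def IsFiniteIndexSubgroupOf (Γ Γ₁ : Set (GL (Fin m) K)) : Prop :=
  ∃ S T : Subgroup (GL (Fin m) K), (S : Set (GL (Fin m) K)) = Γ ∧ (T : Set (GL (Fin m) K)) = Γ₁ ∧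
    S ≤ T ∧ (S.subgroupOf T).FiniteIndex

end Levels

section Ball

/-- The complex 2-ball `𝔇₂ = 𝔇(2,1) = {(z₁,z₂) ∈ ℂ² | |z₁|² + |z₂|² < 1}` ([Sh79] (8.1));
`𝔥²_ℂ` of [DR15] §1. -/
def ball₂ : Set (Fin 2 → ℂ) := {z | ∑ k, ‖z k‖ ^ 2 < 1}

/-- `J_{2,1} = diag[1, 1, -1]` ([Sh79] §3). -/
def J21 : Matrix (Fin 3) (Fin 3) ℂ := Matrix.diagonal ![1, 1, -1]

/-- `U(2,1) = {α ∈ GL₃(ℂ) | ᵗᾱ J_{2,1} α = J_{2,1}}` ([Sh79] (3.1)), as a predicate on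
complex matrices. -/
def IsInU21 (α : Matrix (Fin 3) (Fin 3) ℂ) : Prop := αᴴ * J21 * α = J21

/-- Homogeneous coordinates `(z₁, z₂, 1)` of a point of the affine chart. -/
def homog (z : Fin 2 → ℂ) : Fin 3 → ℂ := Fin.snoc z 1

/-- The action of `α ∈ U(2,1)` on the ball in the affine chart: `α(z)` is the point with
homogeneous coordinates `α · (z₁, z₂, 1)` ([Sh79] (3.3)–(3.4): `α Y(z) = Y(α(z)) diag[…]`).
Junk value (division by `0`) off the ball or off `U(2,1)`. -/
def ballAction (α : Matrix (Fin 3) (Fin 3) ℂ) (z : Fin 2 → ℂ) : Fin 2 → ℂ :=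
  fun k => (α *ᵥ homog z) (Fin.castSucc k) / (α *ᵥ homog z) (Fin.last 2)

/-- A holomorphic 1-form `ξ = q₁ dz₁ + q₂ dz₂` on the ball is recorded by its coefficient map
`q : ℂ² → ℂ²`, holomorphic on `ball₂`. -/
def IsHolomorphicOneForm (q : (Fin 2 → ℂ) → (Fin 2 → ℂ)) : Prop :=
  DifferentiableOn ℂ q ball₂

/-- `dξ = 0` on the ball: `∂q₁/∂z₂ = ∂q₂/∂z₁` ([Sh79] p. 589–590 proves closedness of `ξ`). -/
def IsClosedOneForm (q : (Fin 2 → ℂ) → (Fin 2 → ℂ)) : Prop :=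
  ∀ z ∈ ball₂,
    fderiv ℂ (fun w => q w 0) z (Pi.single 1 1) = fderiv ℂ (fun w => q w 1) z (Pi.single 0 1)

/-- `α^* ξ = ξ` on the ball for one `α ∈ U(2,1)`: `∑ᵢ qᵢ(α z) ∂αᵢ/∂z_j = q_j(z)`
([Sh79] (8.5) and the line after (8.4): `ξ ∘ α = t(α) ξ`, with `Γ = Ker(t)`). -/
def IsInvariantUnder (α : Matrix (Fin 3) (Fin 3) ℂ) (q : (Fin 2 → ℂ) → (Fin 2 → ℂ)) : Prop :=
  ∀ z ∈ ball₂, ∀ j : Fin 2,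
    ∑ i : Fin 2, q (ballAction α z) i * fderiv ℂ (ballAction α) z (Pi.single j 1) i = q z j

/-- `ξ₁ ∧ ξ₂ ≠ 0` on the ball: the `2×2` determinant of the coefficients is not identically
zero ([Sh79] Theorem 8.1: "`ξ₁ ∧ ⋯ ∧ ξ_{m-1} ≠ 0`"). -/
def WedgeNonzero (q₁ q₂ : (Fin 2 → ℂ) → (Fin 2 → ℂ)) : Prop :=
  ∃ z ∈ ball₂, q₁ z 0 * q₂ z 1 - q₁ z 1 * q₂ z 0 ≠ 0

end Ball

section Transfer

variable (K : Type*) [Field K] [NumberField K] [IsCMField K]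

/-- The real-points embedding of the unitary group at the distinguished place: `γ ↦ Q τ₁(γ) Q⁻¹`
where `Q` conjugates `τ₁(H)` to `J_{2,1}` ([Sh79] (4.2)–(4.3): `-iT^{τ₁} = Q₁^ρ J_{r₁,s₁} ᵗQ₁`
and `α ↦ Q₁⁻¹ α^{τ₁ρ} Q₁`; here in the convention `Qᴴ J Q = τ₁(H)`). -/
def realEmbedding (τ₁ : K →+* ℂ) (Q : Matrix (Fin 3) (Fin 3) ℂ) (γ : GL (Fin 3) K) :
    Matrix (Fin 3) (Fin 3) ℂ :=
  Q * (γ : Matrix (Fin 3) (Fin 3) K).map τ₁ * Q⁻¹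

/-- `Q` is a frame: `Qᴴ J_{2,1} Q = τ₁(H)` (exists iff `τ₁(H)` has signature `(2,1)`). -/
def IsFrame (τ₁ : K →+* ℂ) (H : Matrix (Fin 3) (Fin 3) K) (Q : Matrix (Fin 3) (Fin 3) ℂ) :
    Prop :=
  Qᴴ * J21 * Q = H.map τ₁ ∧ IsUnit Q.det

/-- **The instantiated non-vanishing input** (conclusion of [Sh79] Theorem 8.1, p. 588, for
`m = 3`, in the compact case `g > 1`, on the transfer's data): given the CM-field `K`, a
hermitian `H` on `K³` with the Picard signature at `τ₁`, a lattice `𝔪`, and a frame `Q`,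
there is a subgroup `Γ` of finite index in `Γ₁ = shimuraLevel K H 𝔪 1` and two holomorphic
1-forms `ξ₁, ξ₂` on the ball, closed, invariant under `Γ` (through `realEmbedding τ₁ Q`),
with `ξ₁ ∧ ξ₂ ≠ 0`.  ([Sh79] p. 589: for compact `Γ\𝔇` the cohomology classes are then
automatically non-zero; the proof gives `Γ = Ker(t)` with `[Γ_N : Γ] ≤ 4` for a suitably
large even `N`.) -/
def NonVanishingInput (τ₁ : K →+* ℂ) (H : Matrix (Fin 3) (Fin 3) K)
    (𝔪 : Submodule ℤ (Fin 3 → K)) (Q : Matrix (Fin 3) (Fin 3) ℂ) : Prop :=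
  ∃ Γ : Set (GL (Fin 3) K), IsFiniteIndexSubgroupOf K Γ (shimuraLevel K H 𝔪 1) ∧
    ∃ q₁ q₂ : (Fin 2 → ℂ) → (Fin 2 → ℂ),
      IsHolomorphicOneForm q₁ ∧ IsHolomorphicOneForm q₂ ∧
      IsClosedOneForm q₁ ∧ IsClosedOneForm q₂ ∧
      (∀ γ ∈ Γ, IsInvariantUnder (realEmbedding K τ₁ Q γ) q₁) ∧
      (∀ γ ∈ Γ, IsInvariantUnder (realEmbedding K τ₁ Q γ) q₂) ∧
      WedgeNonzero q₁ q₂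

/-- **[Sh79] Theorem 8.1 instantiated** (the hypothesis list as printed, specialised to the
transfer): for every hermitian `H` on `K³` with the Picard signature at `τ₁` (`s₁ = 1`,
`s₂ = ⋯ = s_g = 0` for `T = ζH`), every lattice `𝔪` (the theorem allows an arbitrary lattice
`𝔪` of `K¹_m`), and every frame `Q`, the `NonVanishingInput` holds.  Compactness of `Γ\𝔇` needs `g > 1`,
i.e. `[K : ℚ] > 2` (`2 < Module.finrank ℚ K`). -/
def ShimuraThm81Instance : Prop :=
  2 < Module.finrank ℚ K →
    ∀ (τ₁ : K →+* ℂ) (H : Matrix (Fin 3) (Fin 3) K) (𝔪 : Submodule ℤ (Fin 3 → K))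
      (Q : Matrix (Fin 3) (Fin 3) ℂ),
      IsHermitianForm K H → IsPicardSignature K τ₁ H → IsLattice K 𝔪 → IsFrame K τ₁ H Q →
        NonVanishingInput K τ₁ H 𝔪 Q

/-- `q(Y_Γ) ≥ k`, the [DR15] shape: the space of `Γ`-invariant holomorphic 1-forms on the ball
(= `H⁰(Y_Γ, Ω¹)`, [DR15] §2: "`q(X)` the irregularity of `X`, given by the dimension of
`H⁰(X, Ω¹_X)`") contains `k` linearly independent elements.  (On a compact quotient every
holomorphic 1-form is closed, so closedness is not imposed here.) -/
def IrregularityAtLeast (τ₁ : K →+* ℂ) (Q : Matrix (Fin 3) (Fin 3) ℂ) (Γ : Set (GL (Fin 3) K))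
    (k : ℕ) : Prop :=
  ∃ q : Fin k → ((Fin 2 → ℂ) → (Fin 2 → ℂ)),
    LinearIndependent ℂ q ∧ ∀ i, IsHolomorphicOneForm (q i) ∧
      ∀ γ ∈ Γ, IsInvariantUnder (realEmbedding K τ₁ Q γ) (q i)

/-- **[DR15] Proposition 3.6 instantiated** (explicit level, `n = 2`): for the level
`Γ = Γ₁(𝔠) ∩ Γ₀(𝔭𝔮)` one has `q(Y_Γ) > 2`, i.e. `IrregularityAtLeast … 3`.  Printed hypotheses
(carried by the parameters, not re-derived here): `𝔠` = the conductor of a Hecke character `λ`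
of `K` with `λ|_F = ω` and infinity type (weight1) `λ_∞(z) = ∏_{v∈Φ} z̄_v/|z_v|`; `𝔭` a prime of
`F` split in `K` and prime to `𝔠`; `𝔮` a prime of `F` not split in `K` if `W(λ³) = (-1)^d`,
and `𝔮 = 𝔬` otherwise.  Ideals are given as ideals of `𝓞 K` (extended from `F`). -/
def DR15Prop36Shape (τ₁ : K →+* ℂ) (H : Matrix (Fin 3) (Fin 3) K) (Q : Matrix (Fin 3) (Fin 3) ℂ)
    (𝔠 𝔭𝔮 : Ideal (𝓞 K)) : Prop :=
  IrregularityAtLeast K τ₁ Q (congruence₁ K H 𝔠 ∩ congruence₀ K H 𝔭𝔮) 3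

/-- Existence of the hermitian data of the transfer: a hermitian form on `K³` with the Picard
signature at `τ₁` ([DR15] Introduction takes such a form as given; it exists by taking
`diag[1, 1, a]` with `a` in the maximal real subfield negative at the place of `τ₁` and
positive at the other real places). -/
def PicardHermitianFormExists (τ₁ : K →+* ℂ) : Prop :=
  ∃ H : Matrix (Fin 3) (Fin 3) K, IsHermitianForm K H ∧ IsPicardSignature K τ₁ H

end Transfer

section Reflex

variable (K : Type*) [Field K] [NumberField K] [IsCMField K] {m : ℕ}

/-- A CM-type of `K` as a choice, for each infinite place, of one of its two complex embeddings
([DR15] §3.1: "a CM type `Φ` on `M` is the choice, for each Archimedean place `v` of `F`, of an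
isomorphism `M ⊗_{F,v} ℝ ≃ ℂ`"; [Sh79] §1: injections `τ₁, …, τ_g` "which form a CM-type").
Only used here for the reflex field; the brief's CM-type combinatorics is seat p1's. -/
structure CMTypeChoice where
  /-- the chosen embedding above each infinite place -/
  emb : InfinitePlace K → (K →+* ℂ)
  /-- it lies above that place -/
  emb_mk : ∀ v, InfinitePlace.mk (emb v) = v

open scoped Classical in
/-- The Hodge-type function `τ ↦ p_τ` of the Shimura datum: `p_τ` = number of positive
eigenvalues of `τ(H)` if `τ` is the embedding chosen by `Φ` at its place, and the number of
negative eigenvalues otherwise (so `p_{τ̄} = q_τ`).  With the Picard signature at `τ₁ = Φ(v₁)`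
this is `2` at `τ₁`, `1` at `τ̄₁`, and `{3, 0}` at the other embeddings. -/
def hodgeType (Φ : CMTypeChoice K) (H : Matrix (Fin m) (Fin m) K) (τ : K →+* ℂ) : ℕ :=
  if Φ.emb (InfinitePlace.mk τ) = τ then (signatureAt K τ H).1 else (signatureAt K τ H).2

/-- The automorphisms of `ℂ` fixing the Hodge-type function. -/
def hodgeStabilizer (Φ : CMTypeChoice K) (H : Matrix (Fin m) (Fin m) K) : Set (ℂ ≃+* ℂ) :=
  {σ | ∀ τ : K →+* ℂ, hodgeType K Φ H ((σ : ℂ →+* ℂ).comp τ) = hodgeType K Φ H τ}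

/-- The **reflex field** of the Shimura datum attached to `(K, H, Φ)`: the fixed field in `ℂ` of
the automorphisms of `ℂ` fixing the Hodge-type function.  [DR15] §1 (after Lemma 1.1):
"by Shimura's theory of canonical models, `Y_Γ` can be defined over a finite abelian extension
of the reflex field `M`" — for the transfer's data (`K` Galois over `ℚ`) this field is `τ₁(K)`,
see `ReflexFieldEqImage`. -/
def reflexField (Φ : CMTypeChoice K) (H : Matrix (Fin m) (Fin m) K) : Subfield ℂ :=
  ⨅ σ ∈ hodgeStabilizer K Φ H, RingHom.eqLocusField (σ : ℂ →+* ℂ) (RingHom.id ℂ)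

/-- Statement shape: the reflex field is the image `τ₁(K)` of the distinguished embedding
(expected when `K/ℚ` is Galois; in general it is `τ₁(K)` composed with the reflex field of
the CM-type `Φ`). -/
def ReflexFieldEqImage (Φ : CMTypeChoice K) (H : Matrix (Fin m) (Fin m) K) (τ₁ : K →+* ℂ) :
    Prop :=
  reflexField K Φ H = τ₁.fieldRange

end Reflex

end

end Summit.Ventures.HodgeRepro2.ShimuraData
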